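import Summits.BirchSwinnertonDyer.BirchSwinnertonDyer.Theorems.Rank1ResidualJetRowDualityCarrier
import Literature.NumberTheory.EllipticCurves.HeegnerPointsOfConductor
import HarnessLib

/-!
# T1 JET (cell `bsd-jet`), road K: the hypothesis `hdual_ℓ` of the row theorem (Jetchev Thm. 5.1 ∕
# Lemma 5.2 (iii) at the prime `λ` above a Kolyvagin prime `ℓ ∤ c`, signed parts) DERIVED from the
# signed Poitou–Tate counting, for the dual module `C' = (w⁻¹ H¹_{𝓕_⌈q⌉(c)^*})^s ⊆ H¹(K, E[p^k])`

HONEST FRAMING (programme file `BSD-LIT2PART-PROGRAMME-v1.md` §HONESTY, verbatim): «no tranche here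
proves BSD; ARM L moves the LITERAL column of an r ≤ 1 census into the kernel-proved-modulo-named-print
column; ARM P changes what «named print» is worth.» THEOREMS ONLY (seat `bsd-jet-pv-1`, session g5;
`--supports stmt-BirchSwinnertonDyer-14418`, helper): no definition, no named fact, no `sorry`.
Nothing is booked; 0 classes move.

## What

`exists_sing_of_kolyvaginPrime`: in the currency of `JET.tamagawaExponent_le_mInfty_of_rowData` (pv-2,
p492296) and for the same explicit dual module `C' := signPart s (w⁻¹ H¹_{𝓕₀^*})` as
`exists_locq_of_pair` (`𝓕₀ = selmerF0 … {v₀, τv₀}`): for every Kolyvagin prime `ℓ ∤ c` (Zhang's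
`IsKolyvaginPrime`: inert in `K`, prime to the conductor) and the prime `λ ∋ ℓ` of `K`,

`∃ Sg (sing : (H_{𝓕₀^λ})^s →+ Sg), ker sing = (H_{𝓕₀})^s ∧ #im sing · #loc_λ(C') = p^k`,

with `Sg = H¹(K_λ, E[p^k])/Kum_λ`, `sing = loc_λ`, GIVEN the local term at `λ`:
`[H¹(K_λ, E[p^k])^s : Kum_λ^s] = (Kum_λ).relIndex (ker(σ_{*,λ} − s)) = p^k` (Jetchev Lemma 5.2 (i)–(ii):
`H¹_f^±` and `H¹_s^±` free of rank one over `ℤ/p^k` — a hypothesis here, `σ_{*,λ} = conjActPlace` at the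
`τ`-fixed `λ`). Ingredients: `relIndex_mul_natCard_map_eq_of_relaxedAt` (the signed counting for
`𝓕₀ ≤ 𝓕₀^λ`), the Weil transport of local images (`natCard_map_localization_map_weilDual`), the
bookkeeping of `…RowDualityPrep` (`λ` is `τ`-fixed, is neither a carrier place nor divides `c`).

References (locators only; no cited FACT is declared): [cite: Jetchev2008, Thm. 5.1, Lemma 5.2
(i)–(iii) (p. 822), proof of Thm. 5.2 ∕ arXiv Thm. 6.3 (pp. 821–823)] [cite: WZhang2014, Notations
(xii) (Kolyvagin primes)] [cite: Howard2004HeegnerKolyvagin, Thm. 2.1.11]. Design: no definitions;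
`K : Type`. Axioms: `propext`, `Classical.choice`, `Quot.sound`.
-/

set_option autoImplicit false

noncomputable section

open scoped Classical Pointwise
open Function NumberField IsDedekindDomain WeierstrassCurve Field
open Literature.NumberTheory.EllipticCurves Literature.NumberTheory.GaloisRepresentations
open Literature.NumberTheory.EllipticCurves.Jetchev2008
open Literature.NumberTheory.GaloisCohomology Literature.NumberTheory.Automorphic
open Literature.NumberTheory.GaloisRepresentations.DiscreteGaloisModule (localTatePairingZMod
  tateDual SelmerStructure)
open Summit.BirchSwinnertonDyer.Rank1Residual.JET.SelmerVocabulary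
open Literature.NumberTheory.NumberFields.Honda1971 (natCast_notMem_of_coprime)

namespace Summit.BirchSwinnertonDyer.Rank1Residual.JET.GlobalDuality

/-! ### Membership in `H¹_𝓕` for classes of `H¹_{𝓕^λ}` is decided at `λ` -/

section RelaxedMem

variable {K : Type} [Field K] [NumberField K] (W : WeierstrassCurve ℚ) (n : ℤ)

/-- For `x ∈ H¹_{𝓕^λ}`: `x ∈ H¹_𝓕 ↔ loc_λ x ∈ 𝓕_λ` (the kernel of `sing : H_{𝓕^λ} → H¹(K_λ)/𝓕_λ`).
[cite: Jetchev2008, Lemma 5.2 (iii) (p. 822)] -/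
theorem mem_selmerGroup_iff_of_mem_relaxedAt
    (𝓕 : SelmerStructure ((W.baseChange K).torsionGaloisModule n)) (l : HeightOneSpectrum (𝓞 K))
    {x : galoisCohomology ((W.baseChange K).torsionGaloisModule n) 1}
    (hx : x ∈ (𝓕.relaxedAt {l}).selmerGroup) :
    x ∈ 𝓕.selmerGroup ↔
      galoisCohomology.localization ((W.baseChange K).torsionGaloisModule n) (Sum.inr l : Place K) 1 x ∈
        𝓕 (Sum.inr l) := by
  rw [SelmerStructure.mem_selmerGroup_iff] at hx ⊢
  refine ⟨fun h => h _, fun h v => ?_⟩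
  rcases v with w | v
  · rw [← relaxedAt_inl W n 𝓕 l w]; exact hx _
  · by_cases hv : v = l
    · subst hv; exact h
    · rw [← relaxedAt_inr_of_ne W n 𝓕 hv]; exact hx _

end RelaxedMem

/-! ### The package `hdual_ℓ` -/

section Ell

variable {K : Type} [Field K] [NumberField K] (W : WeierstrassCurve ℚ) [W.IsElliptic]
  [W.IsGloballyMinimal]
  (τ : K ≃ₐ[ℚ] K) (p k : ℕ) [Fact p.Prime] [NeZero (p ^ k)]
  [Finite (geomTorsion (W.baseChange K) ((p ^ k : ℕ) : ℤ))]
  (e : geomTorsion (W.baseChange K) ((p ^ k : ℕ) : ℤ) → geomTorsion (W.baseChange K) ((p ^ k : ℕ) : ℤ) →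
    AlgebraicClosure K)
  (hμ : ∀ S T, e S T ^ (p ^ k) = 1)
  (hadd₁ : ∀ S₁ S₂ T, e (S₁ + S₂) T = e S₁ T * e S₂ T)
  (hadd₂ : ∀ S T₁ T₂, e S (T₁ + T₂) = e S T₁ * e S T₂)
  (hgal : ∀ (g : absoluteGaloisGroup K) (S T : geomTorsion (W.baseChange K) ((p ^ k : ℕ) : ℤ)),
    g • e S T = e (g • S) (g • T))
  (hnondeg : ∀ T, (∀ S, e S T = 1) → T = 0)
  (hτe : ∀ S T, liftAut τ (e S T) =
    e ((isLiftOfAut_liftAut τ).torsionMap W ((p ^ k : ℕ) : ℤ) S)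
      ((isLiftOfAut_liftAut τ).torsionMap W ((p ^ k : ℕ) : ℤ) T))

include hnondeg hτe in
/-- **The hypothesis `hdual_ℓ` of `JET.tamagawaExponent_le_mInfty_of_rowData`, derived** (Jetchev
Lemma 5.2 (iii) at the prime `λ` of `K` above a Kolyvagin prime `ℓ ∤ c`, `s`-parts, for
`𝓕₀ ≤ 𝓕₀^λ`), for the dual module `C' = signPart s (w⁻¹ H¹_{𝓕₀^*})`: `Sg = H¹(K_λ, E[p^k])/(𝓕₀)_λ`,
`sing = loc_λ` with kernel `H_{𝓕₀}^s`, and `#im sing · #loc_λ(C') = p^k`, GIVEN the local term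
`(Kum_λ).relIndex (ker(σ_{*,λ} − s)) = p^k` at every such `λ` (Lemma 5.2 (i)–(ii)). The prime `λ` is
`τ`-fixed (`ℓ` inert), is not a carrier place (`ℓ ∤ N`, the carrier lies above `N`) and does not
divide `c`, so `(𝓕₀)_λ = Kum_λ`. [cite: Jetchev2008, Lemma 5.2 (p. 822), proof of Thm. 5.2 (p. 821)]
[cite: WZhang2014, Notations (xii)] [cite: Howard2004HeegnerKolyvagin, Thm. 2.1.11] -/
theorem exists_sing_of_kolyvaginPrime (hτ : τ * τ = 1) (hp2 : p ≠ 2)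
    (inv : LocalInvariants K (p ^ k)) (hperf : inv.IsPerfect) (hvan : inv.SumLocalTermEqZero)
    (hSC : inv.SelmerComplement) (hinv : inv.IsConjCompatible τ)
    (𝒯 𝒮 : SelmerStructure ((W.baseChange K).torsionGaloisModule ((p ^ k : ℕ) : ℤ)))
    {c : ℕ} (hc : c ≠ 0)
    (h𝒯σ : ∀ (v w : HeightOneSpectrum (𝓞 K)) (h : τ • v = w), v ∈ placesDividing K c →
      ∀ x : galoisCohomology (((W.baseChange K).torsionGaloisModule ((p ^ k : ℕ) : ℤ)).toLocal
        (Sum.inr v : Place K)) 1,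
      x ∈ 𝒯 (Sum.inr v) → conjActPlace W τ ((p ^ k : ℕ) : ℤ) h x ∈ 𝒯 (Sum.inr w))
    (v₀ : HeightOneSpectrum (𝓞 K))
    (h𝒮σ : ∀ (v w : HeightOneSpectrum (𝓞 K)) (h : τ • v = w), v ∈ ({v₀, τ • v₀} : Finset _) →
      ∀ x : galoisCohomology (((W.baseChange K).torsionGaloisModule ((p ^ k : ℕ) : ℤ)).toLocal
        (Sum.inr v : Place K)) 1,
      x ∈ 𝒮 (Sum.inr v) → conjActPlace W τ ((p ^ k : ℕ) : ℤ) h x ∈ 𝒮 (Sum.inr w))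
    -- the conductor: the carrier place lies above it, Kolyvagin primes are prime to it
    (Ncond : ℕ) (hQN : (Ncond : 𝓞 K) ∈ v₀.asIdeal)
    {s : ℤ} (hs : s = 1 ∨ s = -1)
    -- the local term at the Kolyvagin primes (Lemma 5.2 (i)–(ii))
    (hloc : ∀ ℓ : ℕ, Zhang2014.IsKolyvaginPrime Ncond W K p ℓ → k ≤ Zhang2014.kolyvaginIndex W p ℓ →
      ℓ ∉ c.primeFactors → ∀ (v : HeightOneSpectrum (𝓞 K)), (ℓ : 𝓞 K) ∈ v.asIdeal → ∀ (hfix : τ • v = v),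
      ((W.baseChange K).kummerSelmerStructure ((p ^ k : ℕ) : ℤ) (Sum.inr v)).relIndex
        ((conjActPlace W τ ((p ^ k : ℕ) : ℤ) hfix - s • AddMonoidHom.id _).ker) = p ^ k) :
    ∀ ℓ : ℕ, Zhang2014.IsKolyvaginPrime Ncond W K p ℓ → k ≤ Zhang2014.kolyvaginIndex W p ℓ →
      ℓ ∉ c.primeFactors → ∀ (v : HeightOneSpectrum (𝓞 K)), (ℓ : 𝓞 K) ∈ v.asIdeal →
      ∃ (Sg : Type) (_ : AddCommGroup Sg)
        (sing : signPart W K τ ((p ^ k : ℕ) : ℤ) s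
          (((selmerF0 W ((p ^ k : ℕ) : ℤ) 𝒯 𝒮 (placesDividing K c) {v₀, τ • v₀}).relaxedAt {v}).selmerGroup)
            →+ Sg),
        (∀ x, sing x = 0 ↔ (x : galoisCohomology ((W.baseChange K).torsionGaloisModule ((p ^ k : ℕ) : ℤ)) 1) ∈
          signPart W K τ ((p ^ k : ℕ) : ℤ) s
            (selmerF0 W ((p ^ k : ℕ) : ℤ) 𝒯 𝒮 (placesDividing K c) {v₀, τ • v₀}).selmerGroup) ∧
        Nat.card sing.range *
          Nat.card ((signPart W K τ ((p ^ k : ℕ) : ℤ) s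
            (((inv.dualSelmerStructure _ (selmerF0 W ((p ^ k : ℕ) : ℤ) 𝒯 𝒮 (placesDividing K c)
              {v₀, τ • v₀})).selmerGroup).comap (galoisCohomology.map
              (weilDualIntertwining (W.baseChange K) (p ^ k) e hμ hadd₁ hadd₂ hgal) 1))).map
            (galoisCohomology.localization ((W.baseChange K).torsionGaloisModule ((p ^ k : ℕ) : ℤ))
              (Sum.inr v : Place K) 1)) = p ^ k := by
  intro ℓ hKol hkℓ hℓc v hv
  -- basic facts
  have hp : p.Prime := Fact.out
  have hodd : Odd (p ^ k) := (hp.odd_of_ne_two hp2).pow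
  have hM : ∀ P : geomTorsion (W.baseChange K) ((p ^ k : ℕ) : ℤ), (p ^ k) • P = 0 := fun P => by
    simpa using (W.baseChange K).natAbs_nsmul_geomTorsion P
  have hσσ : ∀ v : HeightOneSpectrum (𝓞 K), τ • τ • v = v := fun v => by
    rw [← mul_smul, hτ, one_smul]
  set Q : Finset (HeightOneSpectrum (𝓞 K)) := {v₀, τ • v₀} with hQ
  have hQτ : ∀ v : HeightOneSpectrum (𝓞 K), τ • v ∈ Q ↔ v ∈ Q := fun v => by
    simp only [hQ, Finset.mem_insert, Finset.mem_singleton]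
    constructor
    · rintro (h | h)
      · right; rw [← h, hσσ]
      · left; simpa [hσσ] using congrArg (τ • ·) h
    · rintro (rfl | rfl)
      · right; rfl
      · left; exact hσσ v₀
  -- the prime `λ = v`: fixed, not a carrier place, prime to `c`
  have hℓ : ℓ.Prime := hKol.1
  have hfix : τ • v = v := smul_place_eq_self_of_natCast_mem τ hℓ.ne_zero hKol.2.2.2.2.1 v hv
  have hcopN : Nat.Coprime ℓ Ncond := (Nat.Prime.coprime_iff_not_dvd hℓ).mpr hKol.2.1
  have hvQ : v ∉ Q := by
    simp only [hQ, Finset.mem_insert, Finset.mem_singleton]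
    rintro (rfl | rfl)
    · exact natCast_notMem_of_coprime hcopN _ hv hQN
    · refine natCast_notMem_of_coprime hcopN _ hv ?_
      have := (HeightOneSpectrum.smul_mem_smul_asIdeal_iff τ v₀ (Ncond : 𝓞 K)).mpr hQN
      rwa [smul_natCast_ringOfIntegers] at this
  have hvc : v ∉ placesDividing K c := by
    rw [mem_placesDividing_iff_natCast_mem hc]
    refine natCast_notMem_of_coprime ((Nat.Prime.coprime_iff_not_dvd hℓ).mpr fun h => ?_) _ hv
    exact hℓc (Nat.mem_primeFactors.mpr ⟨hℓ, h, hc⟩)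
  -- the structure `𝓕₀` and its properties
  set F0 := selmerF0 W ((p ^ k : ℕ) : ℤ) 𝒯 𝒮 (placesDividing K c) Q with hF0
  set Kum := (W.baseChange K).kummerSelmerStructure ((p ^ k : ℕ) : ℤ) with hKum
  set wH := galoisCohomology.map (weilDualIntertwining (W.baseChange K) (p ^ k) e hμ hadd₁ hadd₂ hgal) 1
    with hwH
  have hF0σ := conjActPlace_mem_selmerF0 W τ ((p ^ k : ℕ) : ℤ) 𝒯 𝒮 Q hc h𝒯σ hQτ h𝒮σ
  have hF0inf : ∀ w : InfinitePlace K, F0 (Sum.inl w) = ⊤ := fun w =>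
    addSubgroup_inl_eq_top_of_odd W (p ^ k) hodd w _
  have hF0dinf : ∀ w : InfinitePlace K,
      inv.dualSelmerStructure ((W.baseChange K).torsionGaloisModule ((p ^ k : ℕ) : ℤ)) F0 (Sum.inl w) = ⊤ :=
    fun w => addSubgroup_tateDual_inl_eq_top_of_odd W (p ^ k) hodd w _
  have hF0v : F0 (Sum.inr v) = Kum (Sum.inr v) := by
    rw [hF0, selmerF0_inr, if_neg hvQ, selmerF_inr, if_neg hvc]
  -- an exceptional set containing `λ`
  obtain ⟨S, T, hPT, hST, hTσ, -, hSram, h𝓚⟩ :=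
    exists_symmetric_exceptional W τ p k hτ (placesDividing K c ∪ Q ∪ {v})
  have hcS : ∀ v ∈ placesDividing K c, (Sum.inr v : Place K) ∈ S := fun v hv =>
    (hST v).mpr (hPT (Finset.mem_union_left _ (Finset.mem_union_left _ hv)))
  have hQS : ∀ v ∈ Q, (Sum.inr v : Place K) ∈ S := fun v hv =>
    (hST v).mpr (hPT (Finset.mem_union_left _ (Finset.mem_union_right _ hv)))
  have hvT : v ∈ T := hPT (Finset.mem_union_right _ (Finset.mem_singleton_self v))
  have hF0unr := selmerF0_isUnramifiedOutside W ((p ^ k : ℕ) : ℤ) 𝒯 𝒮 Q (c := c) h𝓚 hcS hQS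
  -- the signed counting for `𝓕₀ ≤ 𝓕₀^λ`
  have key := relIndex_mul_natCard_map_eq_of_relaxedAt W τ ((p ^ k : ℕ) : ℤ) hτ hodd hM inv hperf hvan
    hSC hinv S T hST hTσ hSram hF0unr hF0σ hF0inf hF0dinf hvT hfix hs
  rw [show selmerF0 W ((p ^ k : ℕ) : ℤ) 𝒯 𝒮 (placesDividing K c) Q (Sum.inr v) = Kum (Sum.inr v) from hF0v,
    hloc ℓ hKol hkℓ hℓc v hv hfix] at key
  -- `sing = loc_λ : H_{𝓕₀^λ}^s → H¹(K_λ, E[p^k])/(𝓕₀)_λ`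
  let sing : signPart W K τ ((p ^ k : ℕ) : ℤ) s (F0.relaxedAt {v}).selmerGroup →+
      (galoisCohomology (((W.baseChange K).torsionGaloisModule ((p ^ k : ℕ) : ℤ)).toLocal
        (Sum.inr v : Place K)) 1 ⧸ F0 (Sum.inr v)) :=
    (QuotientAddGroup.mk' _).comp
      ((galoisCohomology.localization ((W.baseChange K).torsionGaloisModule ((p ^ k : ℕ) : ℤ))
        (Sum.inr v : Place K) 1).comp (AddSubgroup.subtype _))
  have hsing : ∀ x, sing x = 0 ↔ (x : galoisCohomology _ 1) ∈
      signPart W K τ ((p ^ k : ℕ) : ℤ) s F0.selmerGroup := by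
    intro x
    obtain ⟨hxF, hxs⟩ := (mem_signPart_iff W K τ _ s _ _).mp x.2
    simp only [sing, AddMonoidHom.comp_apply, QuotientAddGroup.mk'_apply, QuotientAddGroup.eq_zero_iff,
      AddSubgroup.coe_subtype]
    rw [← mem_selmerGroup_iff_of_mem_relaxedAt W _ F0 v hxF, mem_signPart_iff]
    exact ⟨fun h => ⟨h, hxs⟩, fun h => h.1⟩
  have hcard1 : Nat.card sing.range =
      (F0.selmerGroup ⊓ (conjAct W τ ((p ^ k : ℕ) : ℤ) - s • AddMonoidHom.id _).ker).relIndex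
        ((F0.relaxedAt {v}).selmerGroup ⊓ (conjAct W τ ((p ^ k : ℕ) : ℤ) - s • AddMonoidHom.id _).ker) := by
    rw [natCard_range_eq_relIndex sing hsing]; rfl
  -- `#loc_λ(C') = #loc'_λ(H¹_{𝓕₀^*} ∩ (H^D)^s)` by the Weil transport
  have hcard2 : Nat.card ((signPart W K τ ((p ^ k : ℕ) : ℤ) s
      (((inv.dualSelmerStructure _ F0).selmerGroup).comap wH)).map
      (galoisCohomology.localization ((W.baseChange K).torsionGaloisModule ((p ^ k : ℕ) : ℤ))
        (Sum.inr v : Place K) 1)) =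
      Nat.card ((((inv.dualSelmerStructure _ F0).selmerGroup ⊓
        (conjActDual W τ ((p ^ k : ℕ) : ℤ) (p ^ k) - s • AddMonoidHom.id _).ker)).map
        (galoisCohomology.localization (((W.baseChange K).torsionGaloisModule ((p ^ k : ℕ) : ℤ)).tateDual
          (p ^ k)) (Sum.inr v : Place K) 1)) := by
    rw [signPart_comap_map_weilDual W τ p k e hμ hadd₁ hadd₂ hgal hnondeg hτe inv F0 s,
      ← natCard_map_localization_map_weilDual W (p ^ k) e hμ hadd₁ hadd₂ hgal hnondeg (Sum.inr v),
      map_comap_map_weilDual W (p ^ k) e hμ hadd₁ hadd₂ hgal hnondeg]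
  refine ⟨_, inferInstance, sing, hsing, ?_⟩
  rw [hcard1, hcard2, key]

end Ell

end Summit.BirchSwinnertonDyer.Rank1Residual.JET.GlobalDuality

end
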